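import Literature.MathematicalPhysics.QuantumManyBody.OneCoordinateMarginal
import Literature.MathematicalPhysics.QuantumManyBody.BoseGasTrialStateCompactness
import HarnessLib

/-!
# One-coordinate marginals: multipliers depending on one coordinate

Calculus of real multipliers `G(X) = g(c - x_p)` depending on a single coordinate `p = (i,a)` of an
`N`-body configuration, and the three identities linking the weighted energy, the cross term
`∑ ∂G · Re(conj ψ ∂ψ)` and the weighted mass of a trial state to the slice data of
`OneCoordinateMarginal.lean` (slice energy `e`, slice current `j`, marginal mass `m`):

* `integral_weight_energyDensity_eq` : `∫ g(c - x_p) e_Φ = ∫ g(c - t) e(t) dt`;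
* `integral_sum_fderiv_weight_re_eq` : `∫ ∑ ∂G Re(conj Φ ∂Φ) = -∫ g'(c - t) j(t) dt`;
* `integral_weight_normSq_eq` : `∫ g(c - x_p) |Φ|² = ∫ g(c - t) m(t) dt`.

[folklore]
-/

noncomputable section

namespace Literature.MathematicalPhysics.QuantumManyBody.BoseGas

open _root_.MeasureTheory Filter Set Function
open scoped ENNReal NNReal Topology

variable {N : ℕ}
section Multiplier

variable {ψ : Config N → ℂ}



/-- Auxiliary fact for one-coordinate slices. [folklore] -/
theorem hasFDerivAt_coord (p : Fin N × Fin 3) (X : Config N) :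
    HasFDerivAt (fun X : Config N => X p.1 p.2) (coordL p) X := by
  have : (fun X : Config N => X p.1 p.2) = coordL p := by funext X; rfl
  rw [this]
  exact ContinuousLinearMap.hasFDerivAt _

/-- Auxiliary fact for one-coordinate slices. [folklore] -/
theorem coordL_apply_unitVec (p : Fin N × Fin 3) (i : Fin N) (k : Fin 3) :
    coordL p (unitVec i k : Config N) = if (i, k) = p then 1 else 0 := by
  rw [coordL_apply, unitVec]
  by_cases h : (i, k) = p
  · have h1 : i = p.1 := congrArg Prod.fst h
    have h2 : k = p.2 := congrArg Prod.snd h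
    subst h1; subst h2
    simp
  · rw [if_neg h]
    by_cases hi : i = p.1
    · subst hi
      have hk : p.2 ≠ k := fun hk => h (by rw [← hk])
      simp [hk]
    · have : (Pi.single i (EuclideanSpace.single k (1 : ℝ)) : Config N) p.1 = 0 := by
        simp [Ne.symm hi]
      simp [this]

/-- Chain rule for `G(X) = g(c - x_p)`: `∂_{i,k} G = -g'(c - x_p)·δ_{(i,k),p}`. [folklore] -/
theorem fderiv_comp_coord_apply_unitVec {g : ℝ → ℝ} (hg : Differentiable ℝ g) (c : ℝ)
    (p : Fin N × Fin 3) (X : Config N) (i : Fin N) (k : Fin 3) :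
    fderiv ℝ (fun X : Config N => g (c - X p.1 p.2)) X (unitVec i k) =
      if (i, k) = p then -deriv g (c - X p.1 p.2) else 0 := by
  have h1 : HasFDerivAt (fun X : Config N => c - X p.1 p.2) (-coordL p) X := by
    simpa using (hasFDerivAt_coord p X).const_sub c
  have h2 : HasDerivAt g (deriv g (c - X p.1 p.2)) (c - X p.1 p.2) := (hg _).hasDerivAt
  have h3 : HasFDerivAt (fun X : Config N => g (c - X p.1 p.2))
      ((ContinuousLinearMap.toSpanSingleton ℝ (deriv g (c - X p.1 p.2))).comp (-coordL p)) X :=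
    h2.hasFDerivAt.comp X h1
  rw [h3.fderiv]
  have hneg : (-coordL p) (unitVec i k : Config N) = -(if (i, k) = p then (1 : ℝ) else 0) := by
    rw [← coordL_apply_unitVec]; rfl
  simp only [ContinuousLinearMap.comp_apply, hneg, ContinuousLinearMap.toSpanSingleton_apply]
  by_cases h : (i, k) = p <;> simp [h]

/-- Auxiliary fact for one-coordinate slices. [folklore] -/
theorem contDiff_comp_coord {g : ℝ → ℝ} (hg : ContDiff ℝ 1 g) (c : ℝ) (p : Fin N × Fin 3) :
    ContDiff ℝ 1 fun X : Config N => g (c - X p.1 p.2) :=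
  hg.comp (contDiff_const.sub (coordL p).contDiff)

/-- The gradient sum of `G(X) = g(c - x_p)` against any family reduces to the `p`-term. [folklore] -/
theorem sum_fderiv_comp_coord_mul {g : ℝ → ℝ} (hg : Differentiable ℝ g) (c : ℝ) (p : Fin N × Fin 3)
    (X : Config N) (a : Fin N → Fin 3 → ℝ) :
    ∑ i : Fin N, ∑ k : Fin 3, fderiv ℝ (fun X : Config N => g (c - X p.1 p.2)) X (unitVec i k) * a i k =
      -deriv g (c - X p.1 p.2) * a p.1 p.2 := by
  simp_rw [fderiv_comp_coord_apply_unitVec hg c p X]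
  rw [Finset.sum_eq_single p.1, Finset.sum_eq_single p.2]
  · simp
  · intro k _ hk; simp [show (p.1, k) ≠ p from fun h => hk (congrArg Prod.snd h)]
  · simp
  · intro i _ hi
    refine Finset.sum_eq_zero fun k _ => ?_
    simp [show (i, k) ≠ p from fun h => hi (congrArg Prod.fst h)]
  · simp

/-- The squared gradient of `G(X) = g(c - x_p)` is `g'(c - x_p)²`. [folklore] -/
theorem sum_fderiv_comp_coord_sq {g : ℝ → ℝ} (hg : Differentiable ℝ g) (c : ℝ) (p : Fin N × Fin 3)
    (X : Config N) :
    ∑ i : Fin N, ∑ k : Fin 3, (fderiv ℝ (fun X : Config N => g (c - X p.1 p.2)) X (unitVec i k)) ^ 2 =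
      deriv g (c - X p.1 p.2) ^ 2 := by
  simp_rw [fderiv_comp_coord_apply_unitVec hg c p X]
  rw [Finset.sum_eq_single p.1, Finset.sum_eq_single p.2]
  · simp
  · intro k _ hk; simp [show (p.1, k) ≠ p from fun h => hk (congrArg Prod.snd h)]
  · simp
  · intro i _ hi
    refine Finset.sum_eq_zero fun k _ => ?_
    simp [show (i, k) ≠ p from fun h => hi (congrArg Prod.fst h)]
  · simp

end Multiplier

section Identities

variable {L : ℝ}


/-- A trial state has compact support (it vanishes off the bounded box). [folklore] -/
theorem TrialState.hasCompactSupport' (Φ : TrialState N L) : HasCompactSupport Φ.ψ :=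
  IsCompact.of_isClosed_subset (isCompact_closedBall _ _) (isClosed_tsupport _)
    (BoxFace.tsupport_subset_closedBall Φ.eq_zero)

/-- A continuous compactly supported function times a bounded measurable weight is integrable. [folklore] -/
theorem integrable_weight_mul_of_hasCompactSupport {F : Config N → ℝ} (hF : Continuous F)
    (hFs : HasCompactSupport F) {w : Config N → ℝ} (hw : Measurable w) (hwb : ∃ C, ∀ X, |w X| ≤ C) :
    Integrable fun X => w X * F X := by
  obtain ⟨C, hC⟩ := hwb
  have hFi : Integrable F := hF.integrable_of_hasCompactSupport hFs
  exact hFi.bdd_mul (c := C) hw.aestronglyMeasurable (Filter.Eventually.of_forall fun X => by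
    rw [Real.norm_eq_abs]; exact hC X)


/-- **Identity 1** (energy term): `∫ g(c - x_p) e_Φ dX = ∫ g(c - t) e(t) dt`. [folklore] -/
theorem integral_weight_energyDensity_eq {v : ℝ → ℝ≥0∞} (hv : Measurable v) (Φ : TrialState N L)
    (hE : energy v Φ ≠ ⊤) {g : ℝ → ℝ} (hg : Continuous g) (hgb : ∃ C, ∀ t, |g t| ≤ C) (c : ℝ)
    (p : Fin N × Fin 3) :
    ∫ X, g (c - X p.1 p.2) * (kineticDensity Φ.ψ X + interaction v X * (‖Φ.ψ X‖₊ : ℝ≥0∞) ^ 2).toReal =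
      ∫ t, g (c - t) * sliceEnergyReal v Φ.ψ p t := by
  have hdm : Measurable fun X => kineticDensity Φ.ψ X + interaction v X * (‖Φ.ψ X‖₊ : ℝ≥0∞) ^ 2 :=
    measurable_energyDensity hv Φ.contDiff.continuous
  have hdi : Integrable fun X => (kineticDensity Φ.ψ X + interaction v X * (‖Φ.ψ X‖₊ : ℝ≥0∞) ^ 2).toReal :=
    integrable_toReal_of_lintegral_ne_top hdm.aemeasurable (by rwa [energy] at hE)
  obtain ⟨C, hC⟩ := hgb
  have hwm : Measurable fun X : Config N => g (c - X p.1 p.2) :=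
    hg.measurable.comp (measurable_const.sub (measurable_coord' p))
  have hint : Integrable fun X => g (c - X p.1 p.2) *
      (kineticDensity Φ.ψ X + interaction v X * (‖Φ.ψ X‖₊ : ℝ≥0∞) ^ 2).toReal :=
    hdi.bdd_mul (c := C) hwm.aestronglyMeasurable (Filter.Eventually.of_forall fun X => by
      rw [Real.norm_eq_abs]; exact hC _)
  exact integral_weight_mul_eq_slice p (fun t => g (c - t)) hint

/-- **Identity 2** (cross term): `∫ ∑ ∂G·Re(Φ̄∂Φ) dX = -∫ g'(c - t) j(t) dt` for `G = g(c - x_p)`. [folklore] -/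
theorem integral_sum_fderiv_weight_re_eq (Φ : TrialState N L) {g : ℝ → ℝ} (hg : ContDiff ℝ 1 g)
    (hgb : ∃ C, ∀ t, |deriv g t| ≤ C) (c : ℝ) (p : Fin N × Fin 3) :
    ∫ X, ∑ i : Fin N, ∑ k : Fin 3,
        fderiv ℝ (fun X : Config N => g (c - X p.1 p.2)) X (unitVec i k) *
          RCLike.re (starRingEnd ℂ (Φ.ψ X) * fderiv ℝ Φ.ψ X (unitVec i k)) =
      -∫ t, deriv g (c - t) * sliceCurrent Φ.ψ p t := by
  have hgd : Differentiable ℝ g := hg.differentiable one_ne_zero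
  simp_rw [sum_fderiv_comp_coord_mul hgd c p _
    (fun i k => RCLike.re (starRingEnd ℂ (Φ.ψ _) * fderiv ℝ Φ.ψ _ (unitVec i k)))]
  -- the cross density is continuous with compact support
  have hF : Continuous fun X => RCLike.re (starRingEnd ℂ (Φ.ψ X) * fderiv ℝ Φ.ψ X (unitVec p.1 p.2)) :=
    RCLike.continuous_re.comp ((Complex.continuous_conj.comp Φ.contDiff.continuous).mul
      ((Φ.contDiff.continuous_fderiv one_ne_zero).clm_apply continuous_const))
  have hFs : HasCompactSupport fun X => RCLike.re (starRingEnd ℂ (Φ.ψ X) * fderiv ℝ Φ.ψ X (unitVec p.1 p.2)) := by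
    refine (TrialState.hasCompactSupport' Φ).mono ?_
    intro X hX
    rw [Function.mem_support] at hX ⊢
    contrapose! hX
    simp [hX]
  obtain ⟨C, hC⟩ := hgb
  have hwm : Measurable fun X : Config N => -deriv g (c - X p.1 p.2) :=
    ((hg.continuous_deriv le_rfl).measurable.comp (measurable_const.sub (measurable_coord' p))).neg
  have hint := integrable_weight_mul_of_hasCompactSupport hF hFs hwm ⟨C, fun X => by
    rw [abs_neg]; exact hC _⟩
  rw [integral_weight_mul_eq_slice p (fun t => -deriv g (c - t)) hint, ← integral_neg]
  refine integral_congr_ae (Filter.Eventually.of_forall fun t => ?_)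
  simp only [sliceCurrent, neg_mul]

/-- **Identity 3** (mass term): `∫ g(c - x_p)|Φ|² dX = ∫ g(c - t) m(t) dt`. [folklore] -/
theorem integral_weight_normSq_eq (Φ : TrialState N L) {g : ℝ → ℝ} (hg : Continuous g)
    (hgb : ∃ C, ∀ t, |g t| ≤ C) (c : ℝ) (p : Fin N × Fin 3) :
    ∫ X, g (c - X p.1 p.2) * ‖Φ.ψ X‖ ^ 2 = ∫ t, g (c - t) * marginalMassReal Φ.ψ p t := by
  have hF : Continuous fun X => ‖Φ.ψ X‖ ^ 2 := (Φ.contDiff.continuous.norm).pow 2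
  have hFs : HasCompactSupport fun X => ‖Φ.ψ X‖ ^ 2 := by
    refine (TrialState.hasCompactSupport' Φ).mono ?_
    intro X hX
    rw [Function.mem_support] at hX ⊢
    contrapose! hX
    simp [hX]
  obtain ⟨C, hC⟩ := hgb
  have hwm : Measurable fun X : Config N => g (c - X p.1 p.2) :=
    hg.measurable.comp (measurable_const.sub (measurable_coord' p))
  have hint := integrable_weight_mul_of_hasCompactSupport hF hFs hwm ⟨C, fun X => hC _⟩
  exact integral_weight_mul_eq_slice p (fun t => g (c - t)) hint

end Identities
end Literature.MathematicalPhysics.QuantumManyBody.BoseGas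

end
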